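import Summits.NavierStokesRegularity.FunctionalMining.StrainMomentRateSupAll
import Summits.NavierStokesRegularity.FunctionalMining.VorticityMomentRateSup
import Literature.Analysis.FluidPDE.TorusNSDirectionDissipation
import HarnessLib

/-!
# FunctionalMining — the regularised `Z_q` balance: viscous sign and `Ḟ_ε ≤ C M F_ε` (vorticity moments)

Search for candidate a priori estimates; no regularity claim. Cell `pub-nsfunc`, prove seat (gen 13). First of two
files extending the rows `E.q|T_C|C1` (`VorticityMomentRateSup`, real `q > 2`) to EVERY real `q > 1`
through the regularised moments `F_ε(s) = ∫ (|ω(u s)|² + ε)^{q/2}`, `ε > 0` — the vorticity twin of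
`StrainMomentRegWeight` / `StrainMomentRegBalance`:

* `viscous_reg_nonpos` — `∫ Ψ_ε'(|ω|²)∑ᵢⱼWᵢⱼΔWᵢⱼ ≤ 0` for `q ≥ 1` (Gibbon's Laplacian step
  `integral_deriv_comp_mul_sum_mul_laplacian_torusVorticityTensor`: `−∫Ψ'|∇W|² − ∫Ψ''|∇|ω|²|²`, and
  Constantin's `|∇|ω|²|² ≤ 2|ω|²|∇W|²` (tree `Torus.sum_sq_partialDeriv_torusVorticitySqAt_le`) with
  `2|Ψ_ε''(y)|y ≤ (2−q)Ψ_ε'(y)`);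
* `abs_integral_reg_mul_le'` — productions against the regularised weight for a generic density;
* `reg_hasDerivWithinAt_le` — on a window with a uniform pointwise majorant `|ω|² ≤ M²`, the `C¹`
  balance (tree `hasDerivWithinAt_integral_comp_torusVorticitySqAt_of_contDiffOn_one`),
  `|Ψ_ε'(|ω|²)σ| ≤ (q/2)√2(√(|ω|²+ε))^{q−1}|∇u|²`, Hölder and ONE Calderón–Zygmund step with the sup
  once give `Ḟ_ε ≤ C M F_ε`, `C = q√2K₁^{1/q}` (the constant of the `q > 2` file).

Existential constants; CONTROL rows; static inputs all tree lemmas.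
-/

noncomputable section

open MeasureTheory Finset Set Filter Topology
open scoped InnerProductSpace RealInnerProductSpace ContDiff

namespace Summit.NavierStokesRegularity.FunctionalMining

open Literature.Analysis.FunctionSpaces Literature.Analysis.FunctionSpaces.Torus
  Literature.Analysis.FluidPDE

namespace VorticityMoment

open VorticityL4 StrainMoment
/-! ## 1. The viscous term of the regularised `Z_q` balance is nonpositive (`q ≥ 1`) -/

/-- **Viscous sign for the regularised vorticity weight.** For smooth `v` on `T^d`, `ε > 0` and
real `q ≥ 1`: `∫ Ψ_ε'(|ω|²) ∑ᵢⱼ Wᵢⱼ ΔWᵢⱼ ≤ 0`, `Ψ_ε(y) = (y+ε)^{q/2}` (Gibbon's Laplacian step +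
Constantin's `∑ₖ(∂ₖ|ω|²)² ≤ 2|ω|²∑ₖ∑ᵢⱼ(∂ₖWᵢⱼ)²` + `2|Ψ_ε''(y)|y ≤ (2−q)Ψ_ε'(y)`). [ours] -/
theorem viscous_reg_nonpos {d : Type*} [Fintype d] [DecidableEq d]
    {v : UnitAddTorus d → EuclideanSpace ℝ d} (hv : IsSmooth v) {ε q : ℝ} (hε : 0 < ε)
    (hq : 1 ≤ q) :
    ∫ x, deriv (fun y : ℝ => (y + ε) ^ (q / 2)) (torusVorticitySqAt v x) * ∑ i, ∑ j,
        torusVorticityTensor v i j x * Torus.laplacian (torusVorticityTensor v i j) x ≤ 0 := by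
  have hQ0 : ∀ x, 0 ≤ torusVorticitySqAt v x := torusVorticitySqAt_nonneg v
  have hpos : ∀ x, 0 < torusVorticitySqAt v x + ε := fun x => by linarith [hQ0 x]
  have hmaps : ∀ x, torusVorticitySqAt v x ∈ Ioi (-ε) := fun x => by
    show -ε < torusVorticitySqAt v x; linarith [hQ0 x]
  have hid := integral_deriv_comp_mul_sum_mul_laplacian_torusVorticityTensor hv isOpen_Ioi
    (contDiffOn_rpow_add ε (q / 2)) hmaps
  rw [hid]
  set D2 : UnitAddTorus d → ℝ := fun x => ∑ k, ∑ i, ∑ j,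
    partialDeriv k (torusVorticityTensor v i j) x ^ 2 with hD2
  set KK : UnitAddTorus d → ℝ := fun x => ∑ k, partialDeriv k (torusVorticitySqAt v) x ^ 2 with hKK
  have hD20 : ∀ x, 0 ≤ D2 x := fun x => Finset.sum_nonneg fun k _ => Finset.sum_nonneg fun i _ =>
    Finset.sum_nonneg fun j _ => sq_nonneg _
  have hKK0 : ∀ x, 0 ≤ KK x := fun x => Finset.sum_nonneg fun k _ => sq_nonneg _
  have hKato : ∀ x, KK x ≤ 2 * torusVorticitySqAt v x * D2 x := fun x =>
    Torus.sum_sq_partialDeriv_torusVorticitySqAt_le hv x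
  have hw1 : ∀ x, deriv (fun y : ℝ => (y + ε) ^ (q / 2)) (torusVorticitySqAt v x) =
      q / 2 * (torusVorticitySqAt v x + ε) ^ (q / 2 - 1) := fun x => deriv_rpow_add (hpos x)
  have hw2 : ∀ x, deriv (deriv (fun y : ℝ => (y + ε) ^ (q / 2))) (torusVorticitySqAt v x) =
      q / 2 * (q / 2 - 1) * (torusVorticitySqAt v x + ε) ^ (q / 2 - 2) := fun x =>
    deriv_deriv_rpow_add (hpos x)
  -- pointwise: `−Ψ'' K ≤ Ψ' D2`
  have hpt : ∀ x, -(deriv (deriv (fun y : ℝ => (y + ε) ^ (q / 2))) (torusVorticitySqAt v x) *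
      KK x) ≤ deriv (fun y : ℝ => (y + ε) ^ (q / 2)) (torusVorticitySqAt v x) * D2 x := by
    intro x
    rw [hw1 x, hw2 x]
    set y := torusVorticitySqAt v x with hy
    have hy0 : 0 ≤ y := hQ0 x
    have hyε : 0 < y + ε := hpos x
    have hA : 0 ≤ (y + ε) ^ (q / 2 - 1) := Real.rpow_nonneg hyε.le _
    have hA2 : 0 ≤ (y + ε) ^ (q / 2 - 2) := Real.rpow_nonneg hyε.le _
    have hrhs : 0 ≤ q / 2 * (y + ε) ^ (q / 2 - 1) * D2 x :=
      mul_nonneg (mul_nonneg (by linarith) hA) (hD20 x)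
    rcases le_or_gt 2 q with hq2 | hq2
    · have h1 : 0 ≤ q / 2 * (q / 2 - 1) * (y + ε) ^ (q / 2 - 2) * KK x :=
        mul_nonneg (mul_nonneg (mul_nonneg (by linarith) (by linarith)) hA2) (hKK0 x)
      linarith
    · have hsplit : (y + ε) ^ (q / 2 - 1) = (y + ε) ^ (q / 2 - 2) * (y + ε) := by
        rw [show q / 2 - 1 = (q / 2 - 2) + 1 by ring, Real.rpow_add hyε, Real.rpow_one]
      have hc : 0 ≤ q / 2 * (1 - q / 2) := mul_nonneg (by linarith) (by linarith)
      have h1 : -(q / 2 * (q / 2 - 1) * (y + ε) ^ (q / 2 - 2) * KK x) =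
          (q / 2 * (1 - q / 2) * (y + ε) ^ (q / 2 - 2)) * KK x := by ring
      have h2 : (q / 2 * (1 - q / 2) * (y + ε) ^ (q / 2 - 2)) * KK x ≤
          (q / 2 * (1 - q / 2) * (y + ε) ^ (q / 2 - 2)) * (2 * y * D2 x) :=
        mul_le_mul_of_nonneg_left (hKato x) (mul_nonneg hc hA2)
      have h3 : (q / 2 * (1 - q / 2) * (y + ε) ^ (q / 2 - 2)) * (2 * y * D2 x) ≤
          q / 2 * (y + ε) ^ (q / 2 - 1) * D2 x := by
        rw [hsplit]
        have h4 : y ≤ y + ε := by linarith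
        have h5 : (q / 2 * (1 - q / 2) * (y + ε) ^ (q / 2 - 2)) * (2 * y * D2 x) =
            (2 - q) * (q / 2 * ((y + ε) ^ (q / 2 - 2) * y) * D2 x) := by ring
        rw [h5]
        have h6 : q / 2 * ((y + ε) ^ (q / 2 - 2) * y) * D2 x ≤
            q / 2 * ((y + ε) ^ (q / 2 - 2) * (y + ε)) * D2 x :=
          mul_le_mul_of_nonneg_right (mul_le_mul_of_nonneg_left
            (mul_le_mul_of_nonneg_left h4 hA2) (by linarith)) (hD20 x)
        have h7 : 0 ≤ q / 2 * ((y + ε) ^ (q / 2 - 2) * (y + ε)) * D2 x :=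
          mul_nonneg (mul_nonneg (by linarith) (mul_nonneg hA2 hyε.le)) (hD20 x)
        have h8 : (2 - q) ≤ 1 := by linarith
        calc (2 - q) * (q / 2 * ((y + ε) ^ (q / 2 - 2) * y) * D2 x)
            ≤ (2 - q) * (q / 2 * ((y + ε) ^ (q / 2 - 2) * (y + ε)) * D2 x) :=
              mul_le_mul_of_nonneg_left h6 (by linarith)
          _ ≤ 1 * (q / 2 * ((y + ε) ^ (q / 2 - 2) * (y + ε)) * D2 x) :=
              mul_le_mul_of_nonneg_right h8 h7
          _ = q / 2 * ((y + ε) ^ (q / 2 - 2) * (y + ε)) * D2 x := one_mul _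
      linarith
  -- integrate
  have hQs : IsSmooth (torusVorticitySqAt v) := by
    have hDc : ∀ m j, IsSmooth (fun y => partialDeriv m v y j) := fun m j => (hv.partialDeriv m).apply j
    have h : ∀ i j, IsSmooth (fun x => ((partialDeriv i v x) j - (partialDeriv j v x) i) ^ 2) :=
      fun i j => ((hDc i j).sub (hDc j i)).pow 2
    have hsum : IsSmooth (fun x => ∑ i, ∑ j, ((partialDeriv i v x) j - (partialDeriv j v x) i) ^ 2) := by
      unfold Torus.IsSmooth at h ⊢
      exact ContDiff.sum fun i _ => ContDiff.sum fun j _ => h i j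
    have e : torusVorticitySqAt v = fun x => 2⁻¹ * ∑ i, ∑ j,
        ((partialDeriv i v x) j - (partialDeriv j v x) i) ^ 2 := rfl
    rw [e]
    exact hsum.smul 2⁻¹
  have hQc : Continuous (torusVorticitySqAt v) := hQs.continuous
  have hWs : ∀ i j, IsSmooth (torusVorticityTensor v i j) := fun i j =>
    ((hv.partialDeriv i).apply j).sub ((hv.partialDeriv j).apply i)
  have hcA : Continuous fun x => deriv (fun y : ℝ => (y + ε) ^ (q / 2)) (torusVorticitySqAt v x) *
      D2 x := by
    have e : (fun x => deriv (fun y : ℝ => (y + ε) ^ (q / 2)) (torusVorticitySqAt v x) * D2 x) =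
        fun x => q / 2 * (torusVorticitySqAt v x + ε) ^ (q / 2 - 1) * D2 x :=
      funext fun x => by rw [hw1 x]
    rw [e]
    refine (continuous_const.mul ((hQc.add continuous_const).rpow_const fun x =>
      Or.inl (hpos x).ne')).mul ?_
    exact continuous_finsetSum _ fun k _ => continuous_finsetSum _ fun i _ =>
      continuous_finsetSum _ fun j _ => ((hWs i j).partialDeriv k).continuous.pow 2
  have hcB : Continuous fun x => deriv (deriv (fun y : ℝ => (y + ε) ^ (q / 2)))
      (torusVorticitySqAt v x) * KK x := by
    have e : (fun x => deriv (deriv (fun y : ℝ => (y + ε) ^ (q / 2))) (torusVorticitySqAt v x) *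
        KK x) = fun x => q / 2 * (q / 2 - 1) * (torusVorticitySqAt v x + ε) ^ (q / 2 - 2) * KK x :=
      funext fun x => by rw [hw2 x]
    rw [e]
    refine (continuous_const.mul ((hQc.add continuous_const).rpow_const fun x =>
      Or.inl (hpos x).ne')).mul ?_
    exact continuous_finsetSum _ fun k _ => (hQs.partialDeriv k).continuous.pow 2
  have hle : ∫ x, -(deriv (deriv (fun y : ℝ => (y + ε) ^ (q / 2))) (torusVorticitySqAt v x) *
      KK x) ≤ ∫ x, deriv (fun y : ℝ => (y + ε) ^ (q / 2)) (torusVorticitySqAt v x) * D2 x :=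
    integral_mono hcB.neg.integrable_unitAddTorus hcA.integrable_unitAddTorus fun x => hpt x
  rw [integral_neg] at hle
  simp only [hD2, hKK] at hle
  linarith

/-! ## 2. `Ḟ_ε ≤ C M F_ε` for the regularised vorticity moment -/

/-- **Productions against a regularised weight (generic density).** For continuous `Q ≥ 0`, if
`|D(x)| ≤ √(Q x) B(x)` pointwise with `B ≥ 0` continuous, then for `ε > 0` and real `q ≥ 0`,
`|∫ Ψ_ε'(Q) D| ≤ (q/2) ∫ (√(Q+ε))^{q−1} B`. [ours] -/
theorem abs_integral_reg_mul_le' {d : Type*} [Fintype d] {Q D B : UnitAddTorus d → ℝ}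
    (hQ : Continuous Q) (hQ0 : ∀ x, 0 ≤ Q x) (hB : Continuous B) (hB0 : ∀ x, 0 ≤ B x)
    (hDB : ∀ x, |D x| ≤ Real.sqrt (Q x) * B x) {ε q : ℝ} (hε : 0 < ε) (hq : 0 ≤ q) :
    |∫ x, deriv (fun y : ℝ => (y + ε) ^ (q / 2)) (Q x) * D x| ≤
      q / 2 * ∫ x, Real.sqrt (Q x + ε) ^ (q - 1) * B x := by
  have hpos : ∀ x, 0 < Q x + ε := fun x => by linarith [hQ0 x]
  have hpt : ∀ x, |deriv (fun y : ℝ => (y + ε) ^ (q / 2)) (Q x) * D x| ≤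
      q / 2 * (Real.sqrt (Q x + ε) ^ (q - 1) * B x) := by
    intro x
    rw [deriv_rpow_add (hpos x)]
    have hw0 : 0 ≤ q / 2 * (Q x + ε) ^ (q / 2 - 1) :=
      mul_nonneg (by linarith) (Real.rpow_nonneg (hpos x).le _)
    rw [abs_mul, abs_of_nonneg hw0]
    have h1 : Real.sqrt (Q x) ≤ Real.sqrt (Q x + ε) := Real.sqrt_le_sqrt (by linarith)
    have h2 : (Q x + ε) ^ (q / 2 - 1) * Real.sqrt (Q x + ε) = Real.sqrt (Q x + ε) ^ (q - 1) := by
      rw [sqrt_rpow_eq (hpos x).le, Real.sqrt_eq_rpow, ← Real.rpow_add (hpos x)]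
      congr 1; ring
    calc q / 2 * (Q x + ε) ^ (q / 2 - 1) * |D x|
        ≤ q / 2 * (Q x + ε) ^ (q / 2 - 1) * (Real.sqrt (Q x) * B x) :=
          mul_le_mul_of_nonneg_left (hDB x) hw0
      _ ≤ q / 2 * (Q x + ε) ^ (q / 2 - 1) * (Real.sqrt (Q x + ε) * B x) :=
          mul_le_mul_of_nonneg_left (mul_le_mul_of_nonneg_right h1 (hB0 x)) hw0
      _ = q / 2 * (((Q x + ε) ^ (q / 2 - 1) * Real.sqrt (Q x + ε)) * B x) := by ring
      _ = q / 2 * (Real.sqrt (Q x + ε) ^ (q - 1) * B x) := by rw [h2]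
  have hc : Continuous fun x => q / 2 * (Real.sqrt (Q x + ε) ^ (q - 1) * B x) := by
    refine continuous_const.mul ((Continuous.rpow_const ?_ fun x => Or.inl ?_).mul hB)
    · exact (hQ.add continuous_const).sqrt
    · exact (Real.sqrt_pos.2 (hpos x)).ne'
  calc |∫ x, deriv (fun y : ℝ => (y + ε) ^ (q / 2)) (Q x) * D x|
      ≤ ∫ x, |deriv (fun y : ℝ => (y + ε) ^ (q / 2)) (Q x) * D x| := abs_integral_le_integral_abs
    _ ≤ ∫ x, q / 2 * (Real.sqrt (Q x + ε) ^ (q - 1) * B x) :=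
        integral_mono_of_nonneg (ae_of_all _ fun x => abs_nonneg _) hc.integrable_unitAddTorus
          (ae_of_all _ hpt)
    _ = q / 2 * ∫ x, Real.sqrt (Q x + ε) ^ (q - 1) * B x := integral_const_mul _ _

/-- **`Ḟ_ε ≤ C M F_ε` for `F_ε = ∫(|ω|²+ε)^{q/2}` on a window with a uniform vorticity majorant.**
Along a classical solution of unforced Navier–Stokes/Euler (`ν ≥ 0`) on `T³ × [a, b]` with
`|ω(τ,x)|² ≤ M²` for all `τ ∈ [a, b]` and all `x`, for `ε > 0` and real `q > 1`, at every
`τ ∈ [a, b]` there is a one-sided derivative `D` of `F_ε` within `[a, b]` with `D ≤ q√2K₁^{1/q} M F_ε(τ)`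
(`K₁` a vorticity Calderón–Zygmund constant at `2q`: `∫|∇u|^{2q} ≤ K₁∫|ω|^{2q}`). [ours] -/
theorem reg_hasDerivWithinAt_le {q : ℝ} (hq : 1 < q) {K₁ : ℝ} (hK₁0 : 0 ≤ K₁)
    (hK₁ : ∀ v : UnitAddTorus (Fin 3) → EuclideanSpace ℝ (Fin 3), IsSmooth v → IsDivFree v →
      ∫ x, (∑ k, ‖partialDeriv k v x‖ ^ 2) ^ q ≤ K₁ * ∫ x, ‖BDSV.curl v x‖ ^ (2 * q))
    {a b ν : ℝ} (hab : a < b) (hν : 0 ≤ ν)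
    {u : ℝ → UnitAddTorus (Fin 3) → EuclideanSpace ℝ (Fin 3)} {p : ℝ → UnitAddTorus (Fin 3) → ℝ}
    (hsol : IsClassicalNSSolutionOn (Icc a b) ν 0 u p)
    {M : ℝ} (hM : 0 ≤ M) (hω : ∀ τ ∈ Icc a b, ∀ x, torusVorticitySqAt (u τ) x ≤ M ^ 2)
    {ε : ℝ} (hε : 0 < ε) {τ : ℝ} (hτ : τ ∈ Icc a b) :
    ∃ D : ℝ, HasDerivWithinAt (fun s => ∫ x, (torusVorticitySqAt (u s) x + ε) ^ (q / 2)) D (Icc a b) τ ∧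
      D ≤ q * (Real.sqrt 2 * K₁ ^ (1 / q)) * M * ∫ x, (torusVorticitySqAt (u τ) x + ε) ^ (q / 2) := by
  have hq0 : 0 < q := by linarith
  have hut : IsSmooth (u τ) := hsol.smooth_velocity.isSmooth_slice hτ
  have hdiv : IsDivFree (u τ) := hsol.divFree τ hτ
  have hQ0 : ∀ s x, 0 ≤ torusVorticitySqAt (u s) x := fun s x => torusVorticitySqAt_nonneg _ _
  have hmaps : ∀ s ∈ Icc a b, ∀ x, torusVorticitySqAt (u s) x ∈ Ioi (-ε) := fun s _ x => by
    show -ε < torusVorticitySqAt (u s) x; linarith [hQ0 s x]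
  have hΨ1 : ContDiffOn ℝ 1 (fun y : ℝ => (y + ε) ^ (q / 2)) (Ioi (-ε)) := contDiffOn_rpow_add ε _
  have hD := hsol.hasDerivWithinAt_integral_comp_torusVorticitySqAt_of_contDiffOn_one hab
    isOpen_Ioi hΨ1 hmaps hτ
  refine ⟨_, hD, ?_⟩
  -- the forcing term vanishes
  have h0 : ∀ x, ∑ i, ∑ j, torusVorticityTensor (u τ) i j x *
      (partialDeriv i ((0 : ℝ → UnitAddTorus (Fin 3) → EuclideanSpace ℝ (Fin 3)) τ) x j -
        partialDeriv j ((0 : ℝ → UnitAddTorus (Fin 3) → EuclideanSpace ℝ (Fin 3)) τ) x i) = 0 := by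
    intro x
    have h0' : ∀ i, partialDeriv i (0 : UnitAddTorus (Fin 3) → EuclideanSpace ℝ (Fin 3)) x = 0 := by
      intro i
      simp [Torus.partialDeriv, Torus.lineDeriv]
    simp [h0']
  simp only [h0, mul_zero, integral_zero, add_zero]
  -- names
  obtain ⟨X, hX⟩ : ∃ X : ℝ, X = ∫ x, deriv (fun y : ℝ => (y + ε) ^ (q / 2)) (torusVorticitySqAt (u τ) x) *
      torusStretchingDensity (u τ) x := ⟨_, rfl⟩
  obtain ⟨V, hV⟩ : ∃ V : ℝ, V = ∫ x, deriv (fun y : ℝ => (y + ε) ^ (q / 2)) (torusVorticitySqAt (u τ) x) *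
      ∑ i, ∑ j, torusVorticityTensor (u τ) i j x *
        Torus.laplacian (torusVorticityTensor (u τ) i j) x := ⟨_, rfl⟩
  obtain ⟨Fε, hFε⟩ : ∃ F : ℝ, F = ∫ x, (torusVorticitySqAt (u τ) x + ε) ^ (q / 2) := ⟨_, rfl⟩
  obtain ⟨G, hG⟩ : ∃ G : ℝ, G = ∫ x, (∑ k, ‖partialDeriv k (u τ) x‖ ^ 2) ^ q := ⟨_, rfl⟩
  rw [← hX, ← hV, ← hFε]
  have hQc : Continuous (torusVorticitySqAt (u τ)) := continuous_vorticitySqAt hut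
  have hφc : Continuous fun x => Real.sqrt (torusVorticitySqAt (u τ) x + ε) :=
    (hQc.add continuous_const).sqrt
  have hφq : ∫ x, Real.sqrt (torusVorticitySqAt (u τ) x + ε) ^ q = Fε := by
    rw [hFε]
    exact integral_congr_ae (ae_of_all _ fun x => by
      show Real.sqrt (torusVorticitySqAt (u τ) x + ε) ^ q = (torusVorticitySqAt (u τ) x + ε) ^ (q / 2)
      exact sqrt_rpow_eq (by linarith [hQ0 τ x]))
  have hg0 : ∀ x, 0 ≤ ∑ k, ‖partialDeriv k (u τ) x‖ ^ 2 := fun x =>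
    Finset.sum_nonneg fun k _ => sq_nonneg _
  have hFε0 : 0 ≤ Fε := by
    rw [hFε]; exact integral_nonneg fun x => Real.rpow_nonneg (by linarith [hQ0 τ x]) _
  have hG0 : 0 ≤ G := by rw [hG]; exact integral_nonneg fun x => Real.rpow_nonneg (hg0 x) _
  -- (i) `G ≤ K₁ M^q ∫|ω|^q ≤ K₁ M^q F_ε`
  have hGle : G ≤ K₁ * M ^ q * Fε := by
    have h1 : G ≤ K₁ * ∫ x, ‖BDSV.curl (u τ) x‖ ^ (2 * q) := by rw [hG]; exact hK₁ (u τ) hut hdiv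
    have hcq : Continuous fun x => ‖BDSV.curl (u τ) x‖ ^ q := continuous_norm_curl_rpow hut hq0.le
    have h2 : ∫ x, ‖BDSV.curl (u τ) x‖ ^ (2 * q) ≤ M ^ q * ∫ x, ‖BDSV.curl (u τ) x‖ ^ q := by
      rw [← integral_const_mul]
      exact integral_mono_of_nonneg (ae_of_all _ fun x => Real.rpow_nonneg (norm_nonneg _) _)
        (hcq.const_mul _ |>.integrable_unitAddTorus)
        (ae_of_all _ fun x => StrainMoment.norm_curl_rpow_two_mul_le (u τ) x hM hq0.le (hω τ hτ x))
    have h3 : ∫ x, ‖BDSV.curl (u τ) x‖ ^ q ≤ Fε := by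
      rw [← hφq]
      refine integral_mono_of_nonneg (ae_of_all _ fun x => Real.rpow_nonneg (norm_nonneg _) _)
        ((hφc.rpow_const fun x => Or.inr hq0.le).integrable_unitAddTorus) (ae_of_all _ fun x => ?_)
      show ‖BDSV.curl (u τ) x‖ ^ q ≤ Real.sqrt (torusVorticitySqAt (u τ) x + ε) ^ q
      have e : ‖BDSV.curl (u τ) x‖ = Real.sqrt (torusVorticitySqAt (u τ) x) := by
        rw [← norm_curl_sq, Real.sqrt_sq (norm_nonneg _)]
      rw [e]
      exact Real.rpow_le_rpow (Real.sqrt_nonneg _) (Real.sqrt_le_sqrt (by linarith)) hq0.le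
    calc G ≤ K₁ * ∫ x, ‖BDSV.curl (u τ) x‖ ^ (2 * q) := h1
      _ ≤ K₁ * (M ^ q * Fε) :=
          mul_le_mul_of_nonneg_left (h2.trans (mul_le_mul_of_nonneg_left h3 (Real.rpow_nonneg hM _)))
            hK₁0
      _ = K₁ * M ^ q * Fε := by ring
  -- (ii) `|X| ≤ (q/2) √2 K₁^{1/q} M F_ε`
  have hXle : |X| ≤ q / 2 * (Real.sqrt 2 * (K₁ ^ (1 / q) * M * Fε)) := by
    have hσ : ∀ x, |torusStretchingDensity (u τ) x| ≤ Real.sqrt (torusVorticitySqAt (u τ) x) *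
        (Real.sqrt 2 * ∑ k, ‖partialDeriv k (u τ) x‖ ^ 2) := by
      intro x
      have h := stretchingDensity_sq_le (u τ) x
      have hrhs : 0 ≤ Real.sqrt (torusVorticitySqAt (u τ) x) *
          (Real.sqrt 2 * ∑ k, ‖partialDeriv k (u τ) x‖ ^ 2) := by positivity
      have e : (Real.sqrt (torusVorticitySqAt (u τ) x) *
          (Real.sqrt 2 * ∑ k, ‖partialDeriv k (u τ) x‖ ^ 2)) ^ 2 =
          2 * torusVorticitySqAt (u τ) x * (∑ k, ‖partialDeriv k (u τ) x‖ ^ 2) ^ 2 := by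
        rw [mul_pow, mul_pow, Real.sq_sqrt (hQ0 τ x), Real.sq_sqrt (by norm_num : (0 : ℝ) ≤ 2)]
        ring
      rw [← e] at h
      exact abs_le_of_sq_le_sq' h hrhs |> fun h2 => abs_le.2 ⟨h2.1, h2.2⟩
    have h := abs_integral_reg_mul_le' hQc (hQ0 τ) ((continuous_gradSq hut).const_mul _)
      (fun x => by positivity) hσ hε hq0.le
    rw [← hX] at h
    -- Hölder for `∫ φ_ε^{q-1} (√2 g) = √2 ∫ φ_ε^{q-1} g`
    have h' := integral_rpow_mul_le_holder hφc (continuous_gradSq hut) (fun x => Real.sqrt_nonneg _)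
      hg0 hq
    rw [hφq, ← hG] at h'
    have h'' := StrainMoment.holder_sup_chain hFε0 hG0 hK₁0 hM hq0 h' hGle
    have e2 : ∫ x, Real.sqrt (torusVorticitySqAt (u τ) x + ε) ^ (q - 1) *
        (Real.sqrt 2 * ∑ k, ‖partialDeriv k (u τ) x‖ ^ 2) =
        Real.sqrt 2 * ∫ x, Real.sqrt (torusVorticitySqAt (u τ) x + ε) ^ (q - 1) *
          ∑ k, ‖partialDeriv k (u τ) x‖ ^ 2 := by
      rw [← integral_const_mul]
      exact integral_congr_ae (ae_of_all _ fun x => by ring)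
    rw [e2] at h
    exact h.trans (mul_le_mul_of_nonneg_left (mul_le_mul_of_nonneg_left h'' (Real.sqrt_nonneg 2))
      (by linarith))
  -- (iii) assemble: `νV ≤ 0`, `2X ≤ 2|X|`
  have hVle : V ≤ 0 := by rw [hV]; exact viscous_reg_nonpos hut hε hq.le
  have hνV : ν * V ≤ 0 := mul_nonpos_of_nonneg_of_nonpos hν hVle
  have hX' : X ≤ |X| := le_abs_self X
  nlinarith [hXle, hX', hνV]

end VorticityMoment

end Summit.NavierStokesRegularity.FunctionalMining

end
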